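import Literature.MathematicalPhysics.QuantumFieldTheory.Balaban1983to89.B7Eq44TorusAxialGauge
import Literature.MathematicalPhysics.QuantumFieldTheory.Balaban1983to89.B7Eq45TorusGaugeOrbit

/-!
# `Balaban1983to89.B7Eq44TorusAxialGaugeLocal` — T. Bałaban, *Averaging operations for lattice gauge theories*, Commun. Math. Phys. **98** (1985) 17–51
# [Balaban1985Averaging] (44) p. 24 and p. 24 l. −2 – p. 25 l. 2 IN THEIR PRINTED, LOCAL FORM on the periodic lattice of the pub-balaban NE9 chain: SMALL
# PLAQUETTE VARIABLES ON A NON-WRAPPING BOX `□ = x₀ + [0, n]` ⇒ THE AXIAL GAUGE ROOTED AT THE CORNER `x₀` MAKES EVERY BOND OF `□` SMALL — no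
# hypothesis outside `□`, no closed coordinate line ([Balaban1987RG1] (1.12) «for each cube □ ⊂ X … there exists a G-valued gauge transformation u defined
# on □», [Balaban1985BackgroundPropagators] (3.35) «there exists a gauge transformation u on □»)

statement-level skeleton of published theorems with citation tags; proofs where landed; nothing here is a claim about the Yang–Mills mass gap

PDF held: `paper:balaban1985-cmp98-averaging` (journal page = PDF page + 16); pp. 24–25 re-read AS IMAGES by this seat (2026-08-22,
`run/shared/lean/pub/pub-balaban/b2b-balaban-ref1/pages/1985-cmp98-averaging/1985-cmp98-averaging-p008-x2.png`, `…-p009-x2.png`);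
`paper:balaban1987-cmp109-rg-i-small-field` p. 262 re-read AS AN IMAGE (`b2b-balaban-ref1/pages/1987-cmp109-rg-I-small-field/…-p014-x2.png`).

THE PRINT (verbatim).  [B7] p. 24: *«We assume that a configuration V defined on a unit lattice Ω′ satisfies |V(∂p) − 1| < α₀, p ⊂ Ω′, (44) …
Let us denote by y the upper right corner of the plaquette p′ and let us introduce locally the axial gauge with the initial point y. This means that we
take the contours Γ_{y,x} = [y, (y₁, …, y_{d−1}, x_d)] ∪ … ∪ [(y₁, x₂, …, x_d), x] for x in some neighborhood of y containing 2^d blocks having the point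
y as one of the corners, and we make a gauge transformation v₀ such that the gauge transformed configuration V₀ = V^{v₀} satisfies the conditions
V₀(Γ_{y,x}) = 1»*; p. 24 l. −2 – p. 25 l. 2: *«The conditions V₀(Γ_{y,x}) = 1 imply V₀(x, x + e₁) = 1, |V₀(x, x + e₂) − 1| < |x₁ − y₁|α₀, …,
|V₀(x, x + e_μ) − 1| < (|x₁ − y₁| + … + |x_{μ−1} − y_{μ−1}|)α₀, μ = 2, …, d, for x in the neighborhood of y»*; p. 25: *«for b ⊂ Δ(p′) we have
|V₀,b − 1| < |b₋ − y|α₀ ≦ dLα₀»*, and *«Let us notice that it is a local result; the bound above depends on bounds for V(∂p) − 1 on Δ(p′)»*.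
[Balaban1987RG1] p. 262 (1.12): *«for each cube □ ⊂ X of a size O(1)LM there exists a G-valued gauge transformation u defined on □ and such, that
U^u = exp iξA, |A|, |∇^ξA| < O(1)LMBα₀ on □»*.

WHY THIS FILE (cell context).  The sibling (A1) `B7Eq44TorusAxialGauge` roots the axial gauge at the origin of the WHOLE periodic lattice of the chain's
E162 model and therefore needs, besides the plaquettes, the closed coordinate lines (its wrapping bonds; no-go in `B7Eq45TorusGaugeOrbit`).  Print's
statement is LOCAL: a cube □ that does not wrap, the plaquettes OF □ only, a gauge ON □.  This file types that local form on the chain's carriers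
(`TSite d P`, `Bond d P`, `B9Eq328GaugeAction.gaugeU`, `B9Eq310DeltaPrime.plaqHolU`): for a corner `x₀` and extents `n` with `n_i + 1 ≤ P_i` (the box
`□ = {x : (x − x₀)~ ≤ n}` does not wrap), the axial gauge ROOTED AT `x₀` (the tree's `axialFn` at the representative `x̃₀`, evaluated at `x̃₀ + (x − x₀)~`)
makes every bond of □ `(Σ_{κ<μ}(x − x₀)_κ)·δ`-close to `1` — `≤ |n|₁·δ` uniformly — assuming `‖U(∂p) − 1‖ ≤ δ` for the plaquettes of □ ONLY.  It is
the per-cube input of print's class (3.35) ∕ (1.12) that a future per-cube locality reduction ([B9] p. 416) would consume; nothing of that reduction here.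

WHAT IS DEFINED AND PROVED (sorry-free; no `Prop` placeholder).
* §1 torus arithmetic (the chain's `TSite d P = Π_i Fin (P_i)` as an additive group, `[∀ i, NeZero (P i)]`): `perSite_add` (the periodic reading is
  additive), `shift_eq_add_single` (`x + e_μ` on the torus IS `shift μ x`), `shift_sub` (`(x + e_μ) − x₀ = (x − x₀) + e_μ`), `liftSite_perSite_of_lt`
  (a vector of `[0, P)^d` is its own representative), `perSite_liftSite_add_liftSite_sub` (`(x̃₀ + (x − x₀)~) mod P = x`).
* §2 **`axialGaugeTAt P U x₀ x := axialFn Ũ x̃₀ (x̃₀ + (x − x₀)~)`** — p. 24's `v₀` with initial point `x₀`, read on the torus through the representative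
  of `x − x₀`; `axialGaugeTAt_mem_U1`.
* §3 **`gaugeU_axialGaugeTAt_of_lt`**: at a bond `(x, μ)` with `(x − x₀)~_μ + 1 < P_μ` the torus gauge action IS the tree's `ℤ^d` axial gauge at
  `(x̃₀ + (x − x₀)~, μ)`; **`plaqSmall_perCfg_box`**: the LOCAL torus hypothesis (plaquettes `p_{κμ}(x)` with `(x − x₀)~ + e_κ + e_μ ≤ n`) gives the
  tree's `PlaqSmall Ũ x̃₀ (x̃₀ + n) δ`.
* §4 **`norm_gaugeU_axialGaugeTAt_sub_one_le`** — p. 24 l. −2 AS PRINTED: for every bond of the box (`(x − x₀)~ + e_μ ≤ n`, `n_i + 1 ≤ P_i`),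
  `‖U^{v₀}(x, μ) − 1‖ ≤ (Σ_{κ<μ} (x − x₀)~_κ)·δ` (`B8Lemma1NonAbelian.axial_bond_bound_sharp` BY NAME); **`…_le_uniform`**: `≤ |n|₁·δ` (print's
  `|b₋ − y|α₀ ≦ dLα₀` for a box of side `L`).
* §5 (v1.1, APPEND-ONLY) THE PRINTED ∃-SENTENCE: `star_axialGaugeTAt` (the rooted gauge of a unitary field is unitary, via the sibling's
  `B7Eq45TorusGaugeOrbit.star_hol_eq_inv`), **`exists_small_gauge_on_box`** («there exists a gauge transformation u defined on □ such that U^u … small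
  on □»: `∃ g, g(x) ∈ U1 ∧ ∀ bonds of □, ‖U^g(b) − 1‖ ≤ |n|₁δ`) and **`exists_small_gauge_on_box_unitary`** (the same with `g(x)* = g(x)⁻¹`,
  `(U^g(b))* = U^g(b)⁻¹` for unitary `U`).
MODEL / DECLARED READINGS.  (M1) the chain's encodings verbatim; general period vector `P`; (M2) hypotheses: unit-bounded bond variables and the
plaquettes OF THE BOX `δ`-close to `1` — nothing outside the box, no closed line; the box must not wrap (`n_i + 1 ≤ P_i`), as print's cube inside a
larger lattice; (M3) constants explicit (`Σ_{κ<μ}`, `|n|₁`).  NOT HERE: the passage to `U^u = exp iξA` (logarithm), the derivative bound `|∇^ξA|` of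
(1.12), anything of [B7] Props 1–4 ∕ [B9] ∕ [I] beyond the quoted sentences.
HONEST SCOPE.  [folklore] finite-lattice bookkeeping on the tree's non-abelian Stokes (used BY NAME); NOT summit progress (cell pub-balaban: NE9 NOT PRINTED
/ NOT PROVED; «NE9 ⇐ the named binders»; spine PROVED 0/9; HONEST DEPENDENCY: continuum YM on T⁴ ⇐ BetaPertH ∧ nine spine estimates (0/9 proved); BetaPertH
⇐ (D1) ∧ (D4) ∧ CAP+tail; G-an2-4 gates asym, D1 and NE2/3/4).  Unit `b2b-balaban-t4-ne9-formalise-leaf-03` (NE9 crux-team leaf prover, gen 61), INTENT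
I-ne9leaf03-g61-1 file (A5); v1 imported (A1) only; v1.1 APPENDS §5 and the import of the sibling (A2) `B7Eq45TorusGaugeOrbit` (decls of v1
byte-identical); modifies nothing else.  Net new unproved facts: 0.
-/

noncomputable section

namespace Literature.MathematicalPhysics.QuantumFieldTheory.Balaban1983to89.B7Eq44TorusAxialGaugeLocal

open B4Sect5Torus (TSite)
open B9SectCLatticeCarrier (Bond shift shift_apply_val shift_apply_ne)
open B7Prop1Explicit (e e_apply hol gaugeAct axialFn U1 plaqWord l1 axialFn_mem hol_mem norm_inv_sub_one_le)
open B8Lemma1NonAbelian (lowPart lowPart_apply lowPart_nonneg lowPart_le_self axial_bond_bound_sharp)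
open B9Eq315QTorus (perSite perCfg perCfg_apply)
open B9Eq315QTorusOnto (liftSite perSite_liftSite)
open B5Eq155FlatAveragingCommute (shift_perSite)
open B9Eq310DeltaPrime (plaqHolU)
open B9Eq328GaugeAction (gaugeU gaugeU_apply gaugeU_apply_dir)
open B7Eq44TorusAxialGauge (liftSite_nonneg liftSite_shift_of_lt hol_perCfg_plaqWord hol_perCfg_plaqWord_of_gt)
open B7Eq45TorusGaugeOrbit (star_hol_eq_inv star_gaugeU)

variable {d : ℕ} (P : Fin d → ℕ) [∀ i, NeZero (P i)]

/-! ## §1 Torus arithmetic: the periodic lattice as an additive group -/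

section Arith

/-- **The periodic reading `ℤ^d → Π_i ℤ/P_i` is additive.** [cite: Balaban1985Averaging, (1) p.17] -/
theorem perSite_add (a b : B7Prop1Explicit.Site d) : perSite P (a + b) = perSite P a + perSite P b := by
  funext i
  apply Fin.ext
  rw [Pi.add_apply, Fin.val_add]
  simp only [perSite, Pi.add_apply]
  have hP : (0 : ℤ) < (P i : ℤ) := by exact_mod_cast Nat.pos_of_ne_zero (NeZero.ne (P i))
  have ha := Int.emod_nonneg (a i) hP.ne'
  have hb := Int.emod_nonneg (b i) hP.ne'
  have hab := Int.emod_nonneg (a i + b i) hP.ne'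
  apply Int.ofNat_inj.mp
  push_cast
  rw [Int.toNat_of_nonneg hab, Int.toNat_of_nonneg ha, Int.toNat_of_nonneg hb]
  exact Int.add_emod _ _ _

/-- The unit step `x ↦ x + e_μ` of `B9SectCLatticeCarrier.shift` IS the addition of `δ_μ` in the additive group of the torus. [cite: Balaban1985Averaging, (1) p.17] -/
theorem shift_eq_add_single (x : TSite d P) (μ : Fin d) : shift μ x = x + Pi.single μ 1 := by
  funext i
  by_cases h : i = μ
  · subst h
    apply Fin.ext
    rw [shift_apply_val, Pi.add_apply, Pi.single_eq_same, Fin.val_add, Fin.val_one', Nat.add_mod_mod]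
  · rw [shift_apply_ne h, Pi.add_apply, Pi.single_eq_of_ne h, add_zero]

/-- `(x + e_μ) − x₀ = (x − x₀) + e_μ` on the torus. [cite: Balaban1985Averaging, (1) p.17] -/
theorem shift_sub (x x₀ : TSite d P) (μ : Fin d) : shift μ x - x₀ = shift μ (x - x₀) := by
  rw [shift_eq_add_single, shift_eq_add_single, add_sub_right_comm]

/-- A vector of the box `[0, P)^d` is its own representative. [cite: Balaban1985Averaging, (1) p.17] -/
theorem liftSite_perSite_of_lt {w : B7Prop1Explicit.Site d} (h0 : 0 ≤ w) (hw : ∀ i, w i < P i) : liftSite (perSite P w) = w := by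
  funext i
  have h1 : w i % (P i : ℤ) = w i := Int.emod_eq_of_lt (h0 i) (hw i)
  simp only [liftSite, perSite, h1, Int.toNat_of_nonneg (h0 i)]

/-- `(x̃₀ + (x − x₀)~) mod P = x`: the representative of `x − x₀` attached at the representative of `x₀` reads back as `x`. [cite: Balaban1985Averaging, (1) p.17] -/
theorem perSite_liftSite_add_liftSite_sub (x₀ x : TSite d P) : perSite P (liftSite x₀ + liftSite (x - x₀)) = x := by
  rw [perSite_add, perSite_liftSite, perSite_liftSite, add_sub_cancel]

end Arith

/-! ## §2 The axial gauge rooted at a corner `x₀` -/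

section Defs

variable {G : Type*} [Group G]

/-- **p. 24's AXIAL GAUGE WITH INITIAL POINT `x₀` ON THE TORUS**: `v₀(x) = Ũ(Γ_{x̃₀, x̃₀ + (x − x₀)~})` — the tree holonomy of the periodic extension from the
representative of the corner along the tree contour to `x̃₀ + (x − x₀)~` (`B7Prop1Explicit.axialFn` BY NAME).  On the box `x₀ + [0, n]`, `n_i + 1 ≤ P_i`,
this is print's `v₀` of the cube; outside it is some group element (irrelevant). [cite: Balaban1985Averaging, p.24] -/
def axialGaugeTAt (U : Bond d P → G) (x₀ : TSite d P) : TSite d P → G :=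
  fun x => axialFn (perCfg P U) (liftSite x₀) (liftSite x₀ + liftSite (x - x₀))

/-- Unfolding. [cite: Balaban1985Averaging, p.24] -/
theorem axialGaugeTAt_apply (U : Bond d P → G) (x₀ x : TSite d P) :
    axialGaugeTAt P U x₀ x = axialFn (perCfg P U) (liftSite x₀) (liftSite x₀ + liftSite (x - x₀)) := rfl

/-- The rooted axial gauge is unit-bounded when the field is. [cite: Balaban1985Averaging, p.24] -/
theorem axialGaugeTAt_mem_U1 {𝔸 : Type*} [NormedRing 𝔸] [NormOneClass 𝔸] {U : Bond d P → 𝔸ˣ} (hU : ∀ b, U b ∈ U1 𝔸) (x₀ x : TSite d P) :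
    axialGaugeTAt P U x₀ x ∈ U1 𝔸 :=
  axialFn_mem (fun _ _ => hU _) _ _

end Defs

/-! ## §3 Inside the box: the torus gauge action is the tree's `ℤ^d` axial gauge; the local plaquette hypothesis -/

section Box

variable {G : Type*} [Group G] (U : Bond d P → G)

/-- **BONDS OF THE BOX**: for `(x − x₀)~_μ + 1 < P_μ` (no wrap relative to the corner) the torus gauge action of `axialGaugeTAt` at `(x, μ)` IS the tree's
axial gauge `V = Ũ^{v₀}` rooted at `x̃₀`, at the bond `(x̃₀ + (x − x₀)~, μ)`. [cite: Balaban1985Averaging, p.24; Balaban1985BackgroundPropagators, (3.28) p.395] -/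
theorem gaugeU_axialGaugeTAt_of_lt (x₀ x : TSite d P) (μ : Fin d) (h : ((x - x₀) μ : ℕ) + 1 < P μ) :
    gaugeU (axialGaugeTAt P U x₀) U (x, μ) =
      gaugeAct (axialFn (perCfg P U) (liftSite x₀)) (perCfg P U) (liftSite x₀ + liftSite (x - x₀)) μ := by
  rw [gaugeU_apply_dir, axialGaugeTAt_apply, axialGaugeTAt_apply, shift_sub, liftSite_shift_of_lt P (x - x₀) μ h, ← add_assoc]
  show _ = _ * perCfg P U (liftSite x₀ + liftSite (x - x₀)) μ * _
  rw [perCfg_apply, perSite_liftSite_add_liftSite_sub]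

variable {𝔸 : Type*} [NormedRing 𝔸] [NormOneClass 𝔸] {U : Bond d P → 𝔸ˣ} (hU : ∀ b, U b ∈ U1 𝔸) (x₀ : TSite d P) {n : B7Prop1Explicit.Site d}
  (hn : ∀ i, n i + 1 ≤ P i) {δ : ℝ}
  (hδ : ∀ (x : TSite d P) (κ μ : Fin d) (hκμ : κ < μ), liftSite (x - x₀) + e κ + e μ ≤ n → ‖(plaqHolU U (x, ⟨(κ, μ), hκμ⟩) : 𝔸) - 1‖ ≤ δ)

include hU hn hδ in
/-- **(44) ON THE BOX ONLY ⇒ the tree's LOCAL plaquette hypothesis `PlaqSmall Ũ x̃₀ (x̃₀ + n) δ`**: a unit plaquette of `ℤ^d` with corners in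
`[x̃₀, x̃₀ + n]` reads, through the periodic extension, a torus plaquette OF THE BOX (both orientations; the exchanged one is the inverse, `U1`).
[cite: Balaban1985Averaging, (44) p.24, p.25] -/
theorem plaqSmall_perCfg_box : B8Lemma1NonAbelian.PlaqSmall (perCfg P U) (liftSite x₀) (liftSite x₀ + n) δ := by
  intro z κ μ hκμ hlo hhi
  set w : B7Prop1Explicit.Site d := z - liftSite x₀ with hw
  have hz : z = liftSite x₀ + w := by rw [hw, add_sub_cancel]
  have hw0 : 0 ≤ w := fun i => by have := hlo i; simp only [hw, Pi.sub_apply, Pi.zero_apply]; linarith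
  have hwn : w + e κ + e μ ≤ n := fun i => by
    have := hhi i; simp only [hw, Pi.add_apply, Pi.sub_apply] at this ⊢; linarith
  have hwlt : ∀ i, w i < P i := fun i => by
    have h1 := hwn i; have h2 := hn i
    simp only [Pi.add_apply, e_apply] at h1
    split_ifs at h1 <;> omega
  have hx : liftSite (perSite P z - x₀) = w := by
    rw [hz, perSite_add, perSite_liftSite, add_sub_cancel_left, liftSite_perSite_of_lt P hw0 hwlt]
  rcases lt_or_gt_of_ne hκμ with h | h
  · rw [hol_perCfg_plaqWord P U z h]
    exact hδ (perSite P z) κ μ h (by rw [hx]; exact hwn)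
  · rw [hol_perCfg_plaqWord_of_gt P U z h]
    have hmem : hol (perCfg P U) z (plaqWord μ κ) ∈ U1 𝔸 := hol_mem (fun x ν => hU _) _ _
    rw [hol_perCfg_plaqWord P U z h] at hmem
    refine (norm_inv_sub_one_le hmem).trans (hδ (perSite P z) μ κ h ?_)
    rw [hx]; intro i; have := hwn i; simp only [Pi.add_apply] at this ⊢; linarith

/-! ## §4 The bound: print's axial-gauge estimate on the box, from the plaquettes of the box only -/

include hU hn hδ in
/-- **p. 24 l. −2 – p. 25 l. 2 AS PRINTED, ON THE TORUS CARRIERS OF THE CHAIN**: for unit-bounded `U`, a corner `x₀`, extents `n` with `n_i + 1 ≤ P_i`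
(the box `□ = x₀ + [0, n]` does not wrap) and `‖U(∂p) − 1‖ ≤ δ` for the plaquettes OF □ only, every bond `(x, μ)` of □ (`(x − x₀)~ + e_μ ≤ n`) satisfies,
in the axial gauge `v₀ = axialGaugeTAt P U x₀` rooted at the corner, `‖U^{v₀}(x, μ) − 1‖ ≤ (Σ_{κ<μ} (x − x₀)~_κ)·δ` — print's
`|V₀(x, x + e_μ) − 1| < (|x₁ − y₁| + … + |x_{μ−1} − y_{μ−1}|)α₀` with `y = x₀`, no closed line, nothing outside □
(`B8Lemma1NonAbelian.axial_bond_bound_sharp` BY NAME). [cite: Balaban1985Averaging, pp.24–25; Balaban1987RG1, (1.12) p.262] -/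
theorem norm_gaugeU_axialGaugeTAt_sub_one_le (x : TSite d P) (μ : Fin d) (hx : liftSite (x - x₀) + e μ ≤ n) :
    ‖((gaugeU (axialGaugeTAt P U x₀) U (x, μ) : 𝔸ˣ) : 𝔸) - 1‖ ≤ l1 (lowPart μ (liftSite (x - x₀))) * δ := by
  have hμ : ((x - x₀) μ : ℕ) + 1 < P μ := by
    have h1 := hx μ; have h2 := hn μ
    simp only [Pi.add_apply, e_apply, if_true, liftSite] at h1
    omega
  rw [gaugeU_axialGaugeTAt_of_lt P U x₀ x μ hμ]
  have h0 := liftSite_nonneg P (x - x₀)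
  have hyx : liftSite x₀ ≤ liftSite x₀ + liftSite (x - x₀) := le_add_of_nonneg_right h0
  have hhi : liftSite x₀ + liftSite (x - x₀) + e μ ≤ liftSite x₀ + n := fun i => by
    have := hx i; simp only [Pi.add_apply] at this ⊢; linarith
  have := axial_bond_bound_sharp (perCfg P U) (fun z κ => hU _) (plaqSmall_perCfg_box P hU x₀ hn hδ) (liftSite x₀) _ μ le_rfl hyx hhi
  rwa [add_sub_cancel_left] at this

include hU hn hδ in
/-- **THE UNIFORM FORM ON THE BOX**: `‖U^{v₀}(b) − 1‖ ≤ |n|₁·δ` for every bond `b` of the box — print's «|V₀,b − 1| < |b₋ − y|α₀ ≦ dLα₀» for a box of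
side `L` (`|n|₁ = Σ_i n_i`; needs `0 ≤ δ`). [cite: Balaban1985Averaging, p.25; Balaban1987RG1, (1.12) p.262] -/
theorem norm_gaugeU_axialGaugeTAt_sub_one_le_uniform (hδ0 : 0 ≤ δ) (x : TSite d P) (μ : Fin d) (hx : liftSite (x - x₀) + e μ ≤ n) :
    ‖((gaugeU (axialGaugeTAt P U x₀) U (x, μ) : 𝔸ˣ) : 𝔸) - 1‖ ≤ l1 n * δ := by
  refine (norm_gaugeU_axialGaugeTAt_sub_one_le P hU x₀ hn hδ x μ hx).trans (mul_le_mul_of_nonneg_right ?_ hδ0)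
  have h0 := liftSite_nonneg P (x - x₀)
  have hle : ∀ κ, lowPart μ (liftSite (x - x₀)) κ ≤ n κ := fun κ => (lowPart_le_self μ h0 κ).trans (by
    have := hx κ; simp only [Pi.add_apply, e_apply] at this; split_ifs at this <;> linarith)
  have hnn : ∀ κ, 0 ≤ lowPart μ (liftSite (x - x₀)) κ := lowPart_nonneg μ h0
  exact_mod_cast Finset.sum_le_sum fun κ _ => by
    have h1 := hle κ; have h2 := hnn κ
    have : ((lowPart μ (liftSite (x - x₀)) κ).natAbs : ℤ) ≤ (n κ).natAbs := by
      rw [Int.natAbs_of_nonneg h2, Int.natCast_natAbs]; exact h1.trans (le_abs_self _)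
    exact_mod_cast this

end Box

/-! ## §5 (v1.1) The printed ∃-sentence: «there exists a gauge transformation u defined on □ such that U^u is small on □» -/

section Exists

variable {𝔸 : Type*} [NormedRing 𝔸] [NormOneClass 𝔸] {U : Bond d P → 𝔸ˣ} (hU : ∀ b, U b ∈ U1 𝔸) (x₀ : TSite d P) {n : B7Prop1Explicit.Site d}
  (hn : ∀ i, n i + 1 ≤ P i) {δ : ℝ} (hδ0 : 0 ≤ δ)
  (hδ : ∀ (x : TSite d P) (κ μ : Fin d) (hκμ : κ < μ), liftSite (x - x₀) + e κ + e μ ≤ n → ‖(plaqHolU U (x, ⟨(κ, μ), hκμ⟩) : 𝔸) - 1‖ ≤ δ)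

omit [NormOneClass 𝔸] in
/-- **The rooted axial gauge of a unitary field is unitary**: `v₀(x)* = v₀(x)⁻¹` (a holonomy of unitary bond variables; the sibling's `star_hol_eq_inv`).
[cite: Balaban1985Averaging, p.24; Balaban1985BackgroundPropagators, (3.5) p.391] -/
theorem star_axialGaugeTAt [StarMul 𝔸] (hUstar : ∀ b, star (U b : 𝔸) = (((U b)⁻¹ : 𝔸ˣ) : 𝔸)) (x : TSite d P) :
    star ((axialGaugeTAt P U x₀ x : 𝔸ˣ) : 𝔸) = (((axialGaugeTAt P U x₀ x)⁻¹ : 𝔸ˣ) : 𝔸) :=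
  star_hol_eq_inv (fun _ _ => hUstar _) _ _

include hU hn hδ0 hδ in
/-- **(1.12) ∕ (3.35) AS PRINTED, ON THE CHAIN's TORUS CARRIERS — «for each cube □ … there exists a G-valued gauge transformation u defined on □ and such
that U^u … small on □»**: for a unit-bounded `U`, a non-wrapping box `□ = x₀ + [0, n]` (`n_i + 1 ≤ P_i`) whose plaquette variables are `δ`-close to `1`,
there is a unit-bounded gauge `g` (the axial gauge rooted at the corner) with `‖U^g(b) − 1‖ ≤ |n|₁·δ` for every bond `b` of □ — no closed line, nothing
outside □. [cite: Balaban1987RG1, (1.11)–(1.12) p.262; Balaban1985BackgroundPropagators, (3.35) p.396; Balaban1985Averaging, pp.24–25] -/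
theorem exists_small_gauge_on_box :
    ∃ g : TSite d P → 𝔸ˣ, (∀ x, g x ∈ U1 𝔸) ∧
      ∀ (x : TSite d P) (μ : Fin d), liftSite (x - x₀) + e μ ≤ n → ‖((gaugeU g U (x, μ) : 𝔸ˣ) : 𝔸) - 1‖ ≤ l1 n * δ :=
  ⟨axialGaugeTAt P U x₀, axialGaugeTAt_mem_U1 P hU x₀, fun x μ hx => norm_gaugeU_axialGaugeTAt_sub_one_le_uniform P hU x₀ hn hδ hδ0 x μ hx⟩

include hU hn hδ0 hδ in
/-- **THE SAME FOR UNITARY LETTERS**: if moreover `U(b)* = U(b)⁻¹`, the gauge `g` is unitary and so is the gauged field on every bond (`star_gaugeU`).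
[cite: Balaban1987RG1, (1.11)–(1.12) p.262; Balaban1985BackgroundPropagators, (3.5) p.391, (3.35) p.396] -/
theorem exists_small_gauge_on_box_unitary [StarMul 𝔸] (hUstar : ∀ b, star (U b : 𝔸) = (((U b)⁻¹ : 𝔸ˣ) : 𝔸)) :
    ∃ g : TSite d P → 𝔸ˣ, (∀ x, g x ∈ U1 𝔸) ∧ (∀ x, star ((g x : 𝔸ˣ) : 𝔸) = (((g x)⁻¹ : 𝔸ˣ) : 𝔸)) ∧
      (∀ b, star ((gaugeU g U b : 𝔸ˣ) : 𝔸) = (((gaugeU g U b)⁻¹ : 𝔸ˣ) : 𝔸)) ∧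
      ∀ (x : TSite d P) (μ : Fin d), liftSite (x - x₀) + e μ ≤ n → ‖((gaugeU g U (x, μ) : 𝔸ˣ) : 𝔸) - 1‖ ≤ l1 n * δ :=
  ⟨axialGaugeTAt P U x₀, axialGaugeTAt_mem_U1 P hU x₀, star_axialGaugeTAt P x₀ hUstar,
    star_gaugeU P hUstar (star_axialGaugeTAt P x₀ hUstar), fun x μ hx => norm_gaugeU_axialGaugeTAt_sub_one_le_uniform P hU x₀ hn hδ hδ0 x μ hx⟩

end Exists

end Literature.MathematicalPhysics.QuantumFieldTheory.Balaban1983to89.B7Eq44TorusAxialGaugeLocal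

end
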